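import Literature.NumberTheory.Transcendental.KZGroundingRelations
import Literature.NumberTheory.Transcendental.SemialgebraicMapsProofs

/-!
# `GenusTwoRealPeriodCell` (stmt-KontsevichZagierPeriods-17657), line `Sketch` — stub `stub_subband`

**One Newton–Leibniz move per sub-band.** The engine of the line (`stub_bandNewtonLeibniz`)
pushes a representation `r` on the closed band `r.domain = {a₀ ≤ x ≤ a₁, α x ≤ y ≤ β x}` down to
the base by KZ's rule (3) [Kontsevich–Zagier 2001, §1.2], with the bounded `ℚ`-semialgebraic
function `F` as its own primitive along the last coordinate, off a null exceptional set `Z` where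
`∂F/∂y` may fail to be `r.integrand`. A two-set cylindrical decomposition cuts the band into closed
sub-bands `KZlog.band C lo hi = {(x, t) | x ∈ C, lo x ≤ t ≤ hi x}` over base cells
`C ⊆ (a₀, a₁)` whose OPEN fibres `(lo x, hi x)` lie in the open fibre `(α x, β x)` and avoid `Z`.
This file proves the single move on one such sub-band (`stub_subband`, registered signature):
the restricted representation `Bd = r|_{band C lo hi}` and the base representation
`b = [C, F (x, hi x) − F (x, lo x)]` exist and `[Bd] − [b] ∈ KZ.newtonLeibnizRel`
(`KZCalculus.lean`, move (3) with `n = 1`, `a := lo`, `b := hi`, primitive `F`).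

The eight clauses of the move: `F` is `ℚ`-semialgebraic on the sub-band (restriction);
`lo`, `hi` are `ℚ`-semialgebraic on `C` with `lo ≤ hi` (hypotheses); the sub-band IS
`{z | init z ∈ C ∧ lo (init z) ≤ z 1 ≤ hi (init z)}` (`rfl`); fibrewise continuity of
`t ↦ F (x, t)` on `[lo x, hi x]` and differentiability on `(lo x, hi x)` are the engine
hypotheses restricted from the fibre `[α x, β x]`, because `α x ≤ lo x` and `hi x ≤ β x` — which
follow from the guard `(lo x, hi x) ⊆ (α x, β x)` ONLY through strictness `lo x < hi x`
(`exists_between`); the `∉ Z` guard feeds the derivative hypothesis. Existence of `Bd`: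
`KZ.IntegralRep.restrict` (the band is `ℚ`-semialgebraic, `KZlog.isSemialgebraic_band`, and lies in
`r.domain`). Existence of `b`: its integrand is `ℚ`-semialgebraic on `C` (composition of `F` with
the `ℚ`-semialgebraic maps `x ↦ (x, hi x)`, `x ↦ (x, lo x)` into `r.domain`,
`IsSemialgebraicFunOn.comp_isSemialgebraicMapOn_holds`), measurable
(`KZ.aestronglyMeasurable_of_isSemialgebraicFunOn`) and bounded by `2M` on `C`, which has finite
measure (`C ⊆ (a₀, a₁)`), hence integrable. Template: `KZ.exists_band_sub_base_mem_newtonLeibnizRel`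
(`KZGroundingRelations.lean`, the integrand-`1` case).

References: M. Kontsevich, D. Zagier, *Periods* (2001), §1.2, rule (3); J. Bochnak, M. Coste,
M.-F. Roy, *Real Algebraic Geometry* (1998), §2.2. No definition, no named fact.
-/

noncomputable section

open Set MeasureTheory Filter
open Literature.NumberTheory.Transcendental
open Literature.ModelTheory.ExponentialFields (IsSemialgebraic)

namespace Summit.KontsevichZagierPeriods.IsogenyCertificates.GenusTwoRealPeriodCellLine

/-! ## Fibre functions over points of `ℝ¹` -/

/-- The fibre function `s ↦ F (Fin.snoc x s)` of `F : ℝ² → ℝ` over `x ∈ ℝ¹` is the fibre function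
`s ↦ F ![x 0, s]` (as `Fin.snoc x s = ![x 0, s]`, coordinatewise `rfl`). [folklore] -/
theorem subband_fibreFun_eq (F : (Fin 2 → ℝ) → ℝ) (x : Fin 1 → ℝ) :
    (fun s : ℝ => F (Fin.snoc x s)) = fun s : ℝ => F ![x 0, s] :=
  funext fun s => congrArg F (funext fun i => by fin_cases i <;> rfl)

/-! ## Semialgebraic sections and finite volume of the base -/

/-- The section map `y ↦ (y, v y)` of a `ℚ`-semialgebraic function `v` on a `ℚ`-semialgebraic
`S ⊆ ℝⁿ` is a `ℚ`-semialgebraic map on `S` (coordinatewise: coordinates and `v`).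
[cite: BochnakCosteRoy1998, §2.2] -/
theorem subband_isSemialgebraicMapOn_snoc {n : ℕ} {S : Set (Fin n → ℝ)} (hS : IsSemialgebraic ℚ S)
    {v : (Fin n → ℝ) → ℝ} (hv : IsSemialgebraicFunOn ℚ S v) :
    IsSemialgebraicMapOn ℚ S (fun y => (Fin.snoc y (v y) : Fin (n + 1) → ℝ)) := by
  -- adapted from `isSemialgebraicMapOn_snoc` (SemialgebraicC1TriangulationProofs.lean)
  refine IsSemialgebraicMapOn.of_forall hS fun j => ?_
  refine Fin.lastCases ?_ (fun i => ?_) j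
  · simpa only [Fin.snoc_last] using hv
  · simpa only [Fin.snoc_castSucc] using isSemialgebraicFunOn_apply hS i

/-- A subset of the strip `{x ∈ ℝ¹ | a₀ < x 0 < a₁}` has finite Lebesgue measure. [folklore] -/
theorem subband_volume_lt_top_of_subset_strip {a₀ a₁ : ℝ} {C : Set (Fin 1 → ℝ)}
    (hC : C ⊆ {x | x 0 ∈ Ioo a₀ a₁}) : volume C < ⊤ := by
  refine (measure_mono ?_ :
    volume C ≤ volume (Set.pi univ fun _ : Fin 1 => Ioo a₀ a₁)).trans_lt ?_
  · intro x hx i _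
    rw [Fin.eq_zero i]
    exact hC hx
  · rw [volume_pi_pi]
    simp

/-! ## The stub -/

/-- **One Newton–Leibniz move per sub-band.** Inside the closed band of the engine, over a
`ℚ`-semialgebraic base set `C ⊆ (a₀, a₁)` with `ℚ`-semialgebraic `lo < hi` whose open sub-band lies in
the open band and avoids the exceptional set `Z`, the sub-band representation (integrand
`r.integrand`) and the base representation `[C, F(·, hi) − F(·, lo)]` exist and differ by ONE
`newtonLeibnizRel` instance with primitive `F` itself. [cite: KontsevichZagier2001, §1.2 rule (3)] -/
theorem stub_subband : ∀ (a₀ a₁ : ℚ) (α β : ℝ → ℝ) (F : (Fin 2 → ℝ) → ℝ)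
    (Z : Set (Fin 2 → ℝ)) (r : KZ.IntegralRep 2),
    r.domain = {p : Fin 2 → ℝ | p 0 ∈ Set.Icc (a₀ : ℝ) a₁ ∧ α (p 0) ≤ p 1 ∧ p 1 ≤ β (p 0)} →
    IsSemialgebraicFunOn ℚ r.domain F → (∃ M : ℝ, ∀ p ∈ r.domain, |F p| ≤ M) →
    (∀ t ∈ Set.Ioo (a₀ : ℝ) a₁, ContinuousOn (fun s : ℝ => F ![t, s]) (Set.Icc (α t) (β t))) →
    (∀ p ∈ r.domain, p 0 ∈ Set.Ioo (a₀ : ℝ) a₁ → α (p 0) < p 1 → p 1 < β (p 0) → p ∉ Z →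
      HasDerivAt (fun s : ℝ => F ![p 0, s]) (r.integrand p) (p 1)) →
    ∀ {C : Set (Fin 1 → ℝ)}, IsSemialgebraic ℚ C → C ⊆ {x | x 0 ∈ Set.Ioo (a₀ : ℝ) a₁} →
    ∀ {lo hi : (Fin 1 → ℝ) → ℝ}, IsSemialgebraicFunOn ℚ C lo → IsSemialgebraicFunOn ℚ C hi →
    (∀ x ∈ C, lo x < hi x) →
    (∀ x ∈ C, ∀ t ∈ Set.Ioo (lo x) (hi x),
      (α (x 0) < t ∧ t < β (x 0)) ∧ (Fin.snoc x t : Fin 2 → ℝ) ∉ Z) →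
    ∃ (Bd : KZ.IntegralRep 2) (b : KZ.IntegralRep 1),
      Bd.domain = KZlog.band C lo hi ∧ Bd.domain ⊆ r.domain ∧ Bd.integrand = r.integrand ∧
      b.domain = C ∧ (b.integrand = fun x => F (Fin.snoc x (hi x)) - F (Fin.snoc x (lo x))) ∧
      KZ.of Bd - KZ.of b ∈ KZ.newtonLeibnizRel := by
  intro a₀ a₁ α β F Z r hdom hF hM hcont hder C hC hCstrip lo hi hlo hhi hlt hguard
  obtain ⟨M, hM⟩ := hM
  -- the closed sub-fibre `[lo x, hi x]` lies in the closed fibre `[α (x 0), β (x 0)]`: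
  -- by strictness `lo x < hi x` and density, from the guard on the OPEN sub-fibre
  have hαlo : ∀ x ∈ C, α (x 0) ≤ lo x := by
    intro x hx
    refine not_lt.1 fun h => ?_
    obtain ⟨t, ht1, ht2⟩ := exists_between (lt_min h (hlt x hx))
    obtain ⟨htα, hthi⟩ := lt_min_iff.1 ht2
    exact lt_asymm htα (hguard x hx t ⟨ht1, hthi⟩).1.1
  have hhiβ : ∀ x ∈ C, hi x ≤ β (x 0) := by
    intro x hx
    refine not_lt.1 fun h => ?_
    obtain ⟨t, ht1, ht2⟩ := exists_between (max_lt h (hlt x hx))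
    obtain ⟨hβt, hlot⟩ := max_lt_iff.1 ht1
    exact lt_asymm hβt (hguard x hx t ⟨hlot, ht2⟩).1.2
  -- the closed sub-band lies in the closed band
  have hsub : KZlog.band C lo hi ⊆ r.domain := by
    intro z hz
    rw [KZlog.mem_band] at hz
    obtain ⟨hzC, h1, h2⟩ := hz
    rw [hdom, mem_setOf_eq]
    exact ⟨Ioo_subset_Icc_self (hCstrip hzC), (hαlo _ hzC).trans h1, h2.trans (hhiβ _ hzC)⟩
  have hsnoc_mem : ∀ x ∈ C, ∀ t ∈ Icc (lo x) (hi x), (Fin.snoc x t : Fin 2 → ℝ) ∈ r.domain :=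
    fun x hx t ht => hsub (KZlog.snoc_mem_band.2 ⟨hx, ht⟩)
  have hhi_mem : ∀ x ∈ C, (Fin.snoc x (hi x) : Fin 2 → ℝ) ∈ r.domain :=
    fun x hx => hsnoc_mem x hx (hi x) (right_mem_Icc.2 (hlt x hx).le)
  have hlo_mem : ∀ x ∈ C, (Fin.snoc x (lo x) : Fin 2 → ℝ) ∈ r.domain :=
    fun x hx => hsnoc_mem x hx (lo x) (left_mem_Icc.2 (hlt x hx).le)
  -- the sub-band representation: restriction of `r`
  have hBsa : IsSemialgebraic ℚ (KZlog.band C lo hi) := KZlog.isSemialgebraic_band hlo hhi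
  let Bd : KZ.IntegralRep 2 := r.restrict (KZlog.band C lo hi) hBsa hsub
  -- the base representation `∫_C (F (x, hi x) - F (x, lo x))`
  have hCm : MeasurableSet C := IsSemialgebraic.measurableSet_holds hC
  have hFhi : IsSemialgebraicFunOn ℚ C (fun x => F (Fin.snoc x (hi x))) :=
    IsSemialgebraicFunOn.comp_isSemialgebraicMapOn_holds hF (subband_isSemialgebraicMapOn_snoc hC hhi)
      fun x hx => hhi_mem x hx
  have hFlo : IsSemialgebraicFunOn ℚ C (fun x => F (Fin.snoc x (lo x))) :=
    IsSemialgebraicFunOn.comp_isSemialgebraicMapOn_holds hF (subband_isSemialgebraicMapOn_snoc hC hlo)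
      fun x hx => hlo_mem x hx
  have hg : IsSemialgebraicFunOn ℚ C (fun x => F (Fin.snoc x (hi x)) - F (Fin.snoc x (lo x))) :=
    IsSemialgebraicFunOn.sub_holds hFhi hFlo
  have hint : IntegrableOn (fun x => F (Fin.snoc x (hi x)) - F (Fin.snoc x (lo x))) C := by
    refine IntegrableOn.of_bound (subband_volume_lt_top_of_subset_strip hCstrip)
      (KZ.aestronglyMeasurable_of_isSemialgebraicFunOn hg hCm) (M + M) ?_
    exact (ae_restrict_mem hCm).mono fun x hx => (norm_sub_le _ _).trans
      (add_le_add (by rw [Real.norm_eq_abs]; exact hM _ (hhi_mem x hx))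
        (by rw [Real.norm_eq_abs]; exact hM _ (hlo_mem x hx)))
  let b : KZ.IntegralRep 1 :=
    ⟨C, fun x => F (Fin.snoc x (hi x)) - F (Fin.snoc x (lo x)), hC, hg, hint⟩
  refine ⟨Bd, b, rfl, hsub, rfl, rfl, rfl, 1, Bd, b, lo, hi, F, hF.mono hsub hBsa, hlo, hhi,
    fun x hx => (hlt x hx).le, rfl, fun x hx => ?_, fun x hx t ht => ?_, fun x _ => rfl, rfl⟩
  · -- fibrewise continuity on the closed sub-fibre
    have hx0 : x 0 ∈ Ioo (a₀ : ℝ) a₁ := hCstrip hx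
    rw [subband_fibreFun_eq]
    exact (hcont (x 0) hx0).mono (Icc_subset_Icc (hαlo x hx) (hhiβ x hx))
  · -- fibrewise derivative on the open sub-fibre, off `Z`
    have hx0 : x 0 ∈ Ioo (a₀ : ℝ) a₁ := hCstrip hx
    obtain ⟨⟨hαt, htβ⟩, hZ⟩ := hguard x hx t ht
    -- the coordinates of `Fin.snoc x t ∈ ℝ²`
    have h0 : (Fin.snoc x t : Fin 2 → ℝ) 0 = x 0 := rfl
    have h1 : (Fin.snoc x t : Fin 2 → ℝ) 1 = t := rfl
    have h := hder (Fin.snoc x t) (hsnoc_mem x hx t (Ioo_subset_Icc_self ht))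
      (by rw [h0]; exact hx0) (by rw [h0, h1]; exact hαt) (by rw [h0, h1]; exact htβ) hZ
    rw [h0, h1] at h
    rw [subband_fibreFun_eq]
    exact h

end Summit.KontsevichZagierPeriods.IsogenyCertificates.GenusTwoRealPeriodCellLine

end
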